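import Mathlib
import HarnessLib
import Summits.HubbardSuperconductivity.HubbardSuperconductivity.Theorems.KLProgrammeKLRegimeSplitGlue
import Summits.HubbardSuperconductivity.HubbardSuperconductivity.Theorems.KLProgrammeKLRegimeSplitPredicatesV3

/-!
# Route `KLProgramme` — the K3-NAMED glue of the split at the V3 predicate bundle `klPredsV3`
# (stmt-HubbardSuperconductivity-19937; DOWNSTREAM of the route file; cell gate-hubbard-kl, seat p1 = C1 lead, g5)

One line (planner g9 V3-R, HOME/STATUS 2026-08-26T11:43:11Z): the generic glue `KLRegimeInductionP` (p2, `KLProgrammeKLRegimeSplitGlue`)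
specialised to the V3 bundle `klPredsV3` of `KLProgrammeKLRegimeSplitPredicatesV3` — the `--glue-by` declaration of the K3 split edit,
whose children of record are `EngineP klPredsV3 klWindowC`, `BetaSplitP klPredsV3 klWindowC`, `CountertermP klPredsV3 klWindowC`,
`TwoPointAssemblyP klPredsV3 klWindowC`.  Nothing else is asserted.
-/

noncomputable section

namespace Summit.HubbardSuperconductivity.HubbardSuperconductivity.Theorems.KLRegimeSplit

set_option linter.dupNamespace false -- summit = problem name (single-conjunct summit), D-0017

/-- **The K3-named glue at the V3 bundle**: the four children at `klPredsV3` imply crux K3 `KLRegimeTwoPointLimit` BY NAME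
(strong induction on the scale index + S0 `MuOfDopingWindow_holds`, all inside `KLRegimeInductionP`). -/
theorem KLRegimeInductionV3 :
    EngineP klPredsV3 klWindowC → BetaSplitP klPredsV3 klWindowC → CountertermP klPredsV3 klWindowC →
      TwoPointAssemblyP klPredsV3 klWindowC →
        Summit.HubbardSuperconductivity.HubbardSuperconductivity.Theses.KLProgramme.KLRegimeTwoPointLimit :=
  KLRegimeInductionP klPredsV3

end Summit.HubbardSuperconductivity.HubbardSuperconductivity.Theorems.KLRegimeSplit

end
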